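import Mathlib
import Literature.Probability.Percolation.PercolationProofs
import Literature.Probability.LatticeModels.ProdBernoulliIndependence
import Literature.Probability.LatticeModels.ProdBernoulliClusterLocality
import Literature.Probability.LatticeModels.ProdBernoulliCoupling
import Literature.Probability.Percolation.KozmaNitzanPinning
import Summits.CriticalPhenomena.PercolationContinuityZ3.Theorems.PercNearOneGluingAdditiveGluingGoodStep24Glue
import HarnessLib

/-! # Crux `PercNearOneGluing.AdditiveGluing` (stmt-CriticalPhenomena-4576), line `subuniform-dead-pocket-maximum`, stub `stub_goodStep` — assembly (siege k24)

Proves the registered helper stubs `stub_goodStepUniqueLow_k24` (UNCONDITIONAL: the inductive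
step `stub_goodStep` when the observer has a unique low neighbour — Kozma–Nitzan's Theorem 5
class, for an arbitrary relay set) and `stub_goodStepOfGlueGood_k24` (the FULL inductive step
`stub_goodStep`, verbatim, from the displayed kernel GLUE-GOOD).  Lands
`--supports stmt-CriticalPhenomena-4576`.

## The reduction (siege k24; files `…GoodStep24Peel/LowOnly/Engine/Glue.lean`)

`GOOD(w, A, o, b)` = KN goodness in the skeleton's selection form.  For `b ∈ A ∌ o` with a low
neighbour, and the induction hypothesis IH (goodness of every weighting with fewer
positive-degree vertices):
1. `stub_goodStepLowOnly_k24`: `GOOD(wᴬ) → GOOD(w)`, `wᴬ` = `w` with the pairs `o–A` killed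
   (peeling lemma = KN Lemma 5 keeping the low star, relay `argmin_A μ_{wᴬ}(· ↔ b)`).
2. `stub_goodStepEngine_k24`: `GOOD(wᴬ)` ⟸ one inequality per layer `S` of the open star of `o`,
   for the branch graph `K/S` (`K` = `w` with the whole star of `o` killed — FEWER positive-degree
   vertices) with the fixed relay `a₀ = argmin_A μ_K(· ↔ b)`.
3. `S = ∅`: minimality of `a₀` (`goodStep24_ker_empty`).  `S = {y}`: the inequality is
   `GOOD(K, A, y, b)` = IH (`goodStep24_clean_singleton` + `stub_goodStepBranch_k24`).
4. `|S| ≥ 2`: the inequality is the kernel **GLUE-GOOD** (`goodStep24_main`, hypothesis `hker`):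
   for a weighting `u`, relays `A ∋ b`, a block `S` disjoint from `A` with `|S| ≥ 2` all of whose
   vertices are BAD (`μ_u(v ↔ b) < μ_u(a₀ ↔ b)`), a selection `sel' W' ∈ A` and ANY minimiser `a₀`
   of `μ_u(· ↔ b)` over `A`,
   `μ_{u/S}(a₀ ↔ b) ≤ μ_{u/S}(S ↔ b) + Σ_{W' ∩ A = ∅} μ_{u/S}(C(S) = W') · μ_u(sel' W' ↔ b in W'ᶜ)`
   ("glued goodness with the UNGLUED worst relay").  For `|S| = 1` it is goodness itself; for a
   block containing a vertex at least as `u`-reliable as `a₀` it is KN Lemma 5 (used inside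
   `goodStep24_main`); the new content is a block of "bad" vertices.  Exact-enumeration evidence (siege k24 lab, attached to the
   item): 0 violations in 1 600 random and ≈ 10⁴ adversarially climbed instances, tight only at
   the gluing-degenerate corner `a₀ ≡ S`.
So `stub_goodStep` ⟸ GLUE-GOOD (`stub_goodStepOfGlueGood_k24`); with at most one BAD low neighbour
every layer with two elements is a good block (`stub_goodStepOneBad_k24`, which contains KN's
Theorems 4–5 classes), in particular with a unique low neighbour (`stub_goodStepUniqueLow_k24`).
No new definitions.
-/

namespace Summit.CriticalPhenomena.PercolationContinuityZ3.Theorems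

open MeasureTheory Set
open Literature.Probability.LatticeModels (prodBernoulli)
open Literature.Probability.Percolation (BondConfig openConn openConnIn openGraph openCluster)
open scoped BigOperators

noncomputable section
open Classical

section GoodStep24MainAux

open Filter
open Literature.Probability.LatticeModels Literature.Probability.Percolation

variable {n : ℕ}

/-- Gluing the empty block changes nothing. [folklore] -/
theorem goodStep24_glue_empty (K : Sym2 (Fin n) → unitInterval) :
    (fun e : Sym2 (Fin n) =>
      if (∀ x ∈ e, x ∈ (∅ : Finset (Fin n))) ∧ ¬ e.IsDiag then 1 else K e) = K := by
  funext e
  rw [if_neg]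
  rintro ⟨hall, -⟩
  induction e using Sym2.ind with
  | h x y => exact Finset.notMem_empty x (hall x (Sym2.mem_mk_left x y))

/-- The branch weighting of the engine (ambient `wᴬ`, block `{o}` killed, `S` glued) is the gluing
along `S` of `K` = `w` with the star of `o` killed. [folklore] -/
theorem goodStep24_branch_weight_eq (w : Sym2 (Fin n) → unitInterval) (A S : Finset (Fin n))
    (o : Fin n) :
    (fun e : Sym2 (Fin n) =>
      if (∀ x ∈ e, x ∈ S) ∧ ¬ e.IsDiag then 1 else
        if (∃ x ∈ e, x ∈ ({o} : Finset (Fin n))) then 0 else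
          (fun e : Sym2 (Fin n) => if (∃ h ∈ A, s(o, h) = e) then 0 else w e) e) =
    (fun e : Sym2 (Fin n) =>
      if (∀ x ∈ e, x ∈ S) ∧ ¬ e.IsDiag then 1 else
        (fun e : Sym2 (Fin n) => if o ∈ e then (0 : unitInterval) else w e) e) := by
  funext e
  by_cases hS : (∀ x ∈ e, x ∈ S) ∧ ¬ e.IsDiag
  · simp only [if_pos hS]
  · simp only [if_neg hS]
    by_cases hoe : o ∈ e
    · have h1 : ∃ x ∈ e, x ∈ ({o} : Finset (Fin n)) := ⟨o, hoe, Finset.mem_singleton_self o⟩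
      rw [if_pos h1, if_pos hoe]
    · have h1 : ¬ ∃ x ∈ e, x ∈ ({o} : Finset (Fin n)) := by
        rintro ⟨x, hx, hxo⟩
        exact hoe (Finset.mem_singleton.1 hxo ▸ hx)
      have h2 : ¬ ∃ h ∈ A, s(o, h) = e := by
        rintro ⟨h, -, rfl⟩
        exact hoe (Sym2.mem_mk_left o h)
      rw [if_neg h1, if_neg hoe, if_neg h2]

/-- Killing the star of an observer with a positive-weight pair strictly decreases the number of
positive-degree vertices. [folklore] -/
theorem goodStep24_card_lt (w : Sym2 (Fin n) → unitInterval) (o y₀ : Fin n)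
    (hy₀ : (w s(o, y₀) : ℝ) ≠ 0) :
    (Finset.univ.filter (fun v : Fin n => ∃ u : Fin n,
        0 < ((fun e : Sym2 (Fin n) => if o ∈ e then (0 : unitInterval) else w e) s(u, v) : ℝ))).card <
      (Finset.univ.filter (fun v : Fin n => ∃ u : Fin n, 0 < (w s(u, v) : ℝ))).card := by
  refine Finset.card_lt_card (Finset.ssubset_iff_subset_ne.2 ⟨fun v hv => ?_, fun heq => ?_⟩)
  · simp only [Finset.mem_filter, Finset.mem_univ, true_and] at hv ⊢
    obtain ⟨u, hu⟩ := hv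
    refine ⟨u, ?_⟩
    by_cases hou : o ∈ s(u, v)
    · rw [if_pos hou] at hu
      simp at hu
    · rwa [if_neg hou] at hu
  · have ho : o ∈ Finset.univ.filter (fun v : Fin n => ∃ u : Fin n, 0 < (w s(u, v) : ℝ)) := by
      simp only [Finset.mem_filter, Finset.mem_univ, true_and]
      refine ⟨y₀, ?_⟩
      rw [Sym2.eq_swap]
      exact lt_of_le_of_ne (unitInterval.nonneg _) (Ne.symm hy₀)
    rw [← heq] at ho
    simp only [Finset.mem_filter, Finset.mem_univ, true_and] at ho
    obtain ⟨u, hu⟩ := ho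
    rw [if_pos (Sym2.mem_mk_right u o)] at hu
    simp at hu

end GoodStep24MainAux

open Filter Literature.Probability.LatticeModels Literature.Probability.Percolation in
/-- **The inductive step `stub_goodStep`, closed modulo the kernel on THIS quadruple's blocks.**
For `b ∈ A ∌ o` with a low neighbour and the induction hypothesis of `stub_goodStep`, goodness of
`(w, A, o, b)` follows from the glued-goodness inequality GLUE-GOOD for the blocks `S` of low
neighbours of `o` with `|S| ≥ 2` only (weighting `K` = the star of `o` killed).  See the module
docstring. [cite: KozmaNitzan2024, §3.2 (Thms 4–5 and Lemma 5, pp. 12–14)] -/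
theorem goodStep24_main :
    ∀ (n : ℕ) (w : Sym2 (Fin n) → unitInterval) (A : Finset (Fin n)) (o b : Fin n),
      b ∈ A → o ∉ A →
      (∃ y : Fin n, y ∉ A ∧ y ≠ o ∧ (w s(o, y) : ℝ) ≠ 0) →
      (∀ w' : Sym2 (Fin n) → unitInterval,
        (Finset.univ.filter (fun v : Fin n => ∃ u : Fin n, 0 < (w' s(u, v) : ℝ))).card
          < (Finset.univ.filter (fun v : Fin n => ∃ u : Fin n, 0 < (w s(u, v) : ℝ))).card →
        ∀ (A' : Finset (Fin n)) (o' b' : Fin n), b' ∈ A' → o' ∉ A' →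
        ∀ (t : ℝ) (sel : Finset (Fin n) → Fin n), (∀ W, sel W ∈ A') →
          (∀ a ∈ A', 1 - t ≤ (prodBernoulli w').real (openConn a b')) →
          (prodBernoulli w').real ((⋃ a ∈ A', openConn o' a) ∩ (openConn o' b')ᶜ)
            + ∑ W ∈ (Finset.univ : Finset (Finset (Fin n))).filter (fun W => o' ∈ W ∧ Disjoint W A'),
                (prodBernoulli w').real {ω : BondConfig (Fin n) | openCluster ω o' = (W : Set (Fin n))}
                  * (prodBernoulli w').real (openConnIn ((W : Set (Fin n))ᶜ) (sel W) b')ᶜ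
            ≤ t) →
      (∀ (S : Finset (Fin n)) (sel : Finset (Fin n) → Fin n) (a₀ : Fin n),
        2 ≤ S.card → o ∉ S → Disjoint S A → (∀ y ∈ S, w s(o, y) ≠ 0) → (∀ W, sel W ∈ A) →
        a₀ ∈ A →
        (∀ a ∈ A, (prodBernoulli (fun e : Sym2 (Fin n) => if o ∈ e then (0 : unitInterval) else w e)).real
            (openConn a₀ b) ≤
          (prodBernoulli (fun e : Sym2 (Fin n) => if o ∈ e then (0 : unitInterval) else w e)).real
            (openConn a b)) →
        (∀ v ∈ S, (prodBernoulli (fun e : Sym2 (Fin n) => if o ∈ e then (0 : unitInterval) else w e)).real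
            (openConn v b) <
          (prodBernoulli (fun e : Sym2 (Fin n) => if o ∈ e then (0 : unitInterval) else w e)).real
            (openConn a₀ b)) →
        (prodBernoulli (fun e : Sym2 (Fin n) =>
            if (∀ x ∈ e, x ∈ S) ∧ ¬ e.IsDiag then 1 else
              (fun e : Sym2 (Fin n) => if o ∈ e then (0 : unitInterval) else w e) e)).real
            (openConn a₀ b) ≤
          (prodBernoulli (fun e : Sym2 (Fin n) =>
              if (∀ x ∈ e, x ∈ S) ∧ ¬ e.IsDiag then 1 else
                (fun e : Sym2 (Fin n) => if o ∈ e then (0 : unitInterval) else w e) e)).real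
              (⋃ s ∈ S, openConn s b)
            + ∑ W' ∈ (Finset.univ : Finset (Finset (Fin n))).filter (fun W' => Disjoint W' A),
                (prodBernoulli (fun e : Sym2 (Fin n) =>
                    if (∀ x ∈ e, x ∈ S) ∧ ¬ e.IsDiag then 1 else
                      (fun e : Sym2 (Fin n) => if o ∈ e then (0 : unitInterval) else w e) e)).real
                    {ω : BondConfig (Fin n) | ∀ x : Fin n, (x ∈ W' ↔ ω ∈ ⋃ s ∈ S, openConn s x)}
                  * (prodBernoulli (fun e : Sym2 (Fin n) =>
                      if o ∈ e then (0 : unitInterval) else w e)).real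
                      (openConnIn ((W' : Set (Fin n))ᶜ) (sel (insert o W')) b)) →
      ∀ (t : ℝ) (sel : Finset (Fin n) → Fin n), (∀ W, sel W ∈ A) →
        (∀ a ∈ A, 1 - t ≤ (prodBernoulli w).real (openConn a b)) →
        (prodBernoulli w).real ((⋃ a ∈ A, openConn o a) ∩ (openConn o b)ᶜ)
          + ∑ W ∈ (Finset.univ : Finset (Finset (Fin n))).filter (fun W => o ∈ W ∧ Disjoint W A),
              (prodBernoulli w).real {ω : BondConfig (Fin n) | openCluster ω o = (W : Set (Fin n))}
                * (prodBernoulli w).real (openConnIn ((W : Set (Fin n))ᶜ) (sel W) b)ᶜ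
          ≤ t := by
  intro n w A o b hb ho hlow IH hker
  refine stub_goodStepLowOnly_k24 n w A o b hb ho ?_
  intro t sel hsel ht
  set wA : Sym2 (Fin n) → unitInterval :=
    fun e => if (∃ h ∈ A, s(o, h) = e) then 0 else w e with hwA
  set K : Sym2 (Fin n) → unitInterval := fun e => if o ∈ e then (0 : unitInterval) else w e with hKdef
  obtain ⟨y₀, -, -, hy₀⟩ := hlow
  -- the designated relay: a minimiser of `μ_K(· ↔ b)` over `A`
  obtain ⟨a₀, ha₀, hmin⟩ :=
    Finset.exists_min_image A (fun a => (prodBernoulli K).real (openConn a b)) ⟨b, hb⟩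
  have hA0 : ∀ a ∈ A, wA s(o, a) = 0 := fun a ha => by
    simp only [hwA]
    rw [if_pos ⟨a, ha, rfl⟩]
  have hKo : ∀ z : Fin n, K s(o, z) = 0 := fun z => by
    simp only [hKdef]
    rw [if_pos (Sym2.mem_mk_left o z)]
  have hKwA : ∀ e : Sym2 (Fin n), o ∉ e → K e = wA e := by
    intro e hoe
    have h2 : ¬ ∃ h ∈ A, s(o, h) = e := by
      rintro ⟨h, -, rfl⟩
      exact hoe (Sym2.mem_mk_left o h)
    simp only [hKdef, hwA]
    rw [if_neg hoe, if_neg h2]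
  refine goodStep24_good_of_engine wA A o b a₀ sel hb ha₀ t ht ?_
  refine stub_goodStepEngine_k24 n wA A o b a₀ sel hb ho ha₀ hA0 ?_
  intro S hoS hSA hSw
  rw [goodStep24_branch_weight_eq w A S o]
  -- positivity of the pairs `o–S` for `w` itself
  have hSw' : ∀ y ∈ S, w s(o, y) ≠ 0 := by
    intro y hy h0
    refine hSw y hy ?_
    simp only [hwA]
    by_cases h : ∃ h ∈ A, s(o, h) = s(o, y)
    · rw [if_pos h]
    · rw [if_neg h, h0]
  rcases S.eq_empty_or_nonempty with rfl | hSne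
  · -- the empty layer
    rw [goodStep24_glue_empty K]
    refine goodStep24_ker_empty wA K A o b a₀ sel ho hsel hmin (fun e he => ?_) fun z _ => hKo z
    refine (hKwA e fun hoe => ?_).symm
    exact (Set.mk_mem_sym2_iff.1 (show s(o, o) ∈ (({o} : Set (Fin n))ᶜ).sym2 from by
      induction e using Sym2.ind with
      | h x y =>
        have hx := (Set.mk_mem_sym2_iff.1 he).1
        have hy := (Set.mk_mem_sym2_iff.1 he).2
        rcases Sym2.mem_iff.1 hoe with rfl | rfl
        · exact absurd rfl hx
        · exact absurd rfl hy)).1 rfl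
  -- a non-empty layer: the branch stub, then singleton = IH, larger = the kernel
  refine stub_goodStepBranch_k24 n wA K A S o b a₀ sel ho hoS hsel hKo hKwA ?_
  by_cases hS1 : S.card = 1
  · obtain ⟨y, rfl⟩ := Finset.card_eq_one.1 hS1
    have hyA : y ∉ A := Finset.disjoint_singleton_left.1 hSA
    refine goodStep24_clean_singleton K A y b a₀ (fun W' => sel (insert o W')) hb
      (fun W' => hsel _) hmin ?_
    exact IH K (goodStep24_card_lt w o y₀ hy₀) A y b hb hyA
  · have h2 : 2 ≤ S.card := by
      have h1 := Finset.card_pos.2 hSne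
      omega
    have hbS : b ∉ S := fun hbS' => Finset.disjoint_left.1 hSA hbS' hb
    by_cases hgood : ∃ v ∈ S, (prodBernoulli K).real (openConn a₀ b) ≤ (prodBernoulli K).real (openConn v b)
    · -- a GOOD block: KN Lemma 5 (`stub_gluingLemma5`), no penalty needed
      obtain ⟨v, hvS, hle⟩ := hgood
      have h5 := stub_gluingLemma5 n K S a₀ v b hvS hbS hle
      exact h5.trans (le_add_of_nonneg_right (Finset.sum_nonneg fun _ _ =>
        mul_nonneg measureReal_nonneg measureReal_nonneg))
    · -- a BAD block: the kernel
      push Not at hgood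
      exact hker S sel a₀ h2 hoS hSA hSw' hsel ha₀ hmin hgood

open Filter Literature.Probability.LatticeModels Literature.Probability.Percolation in
/-- Registered helper stub `stub_goodStepUniqueLow_k24` of crux stmt-CriticalPhenomena-4576 (siege
k24): **the inductive step `stub_goodStep` when the observer has a UNIQUE low neighbour**
(Kozma–Nitzan's Theorem 5 class — `N(o) ⊆ A ∪ {x}` — for an arbitrary relay set `A ∋ b`),
unconditionally: the stub's hypotheses plus "all low neighbours of `o` coincide" give
`GOOD(w, A, o, b)`.  Proof: `goodStep24_main`; no layer of the open star of `o` avoiding `A` has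
two elements. [cite: KozmaNitzan2024, §3.2 Thm 5 (pp. 13–14)] -/
theorem stub_goodStepUniqueLow_k24 :
    ∀ (n : ℕ) (w : Sym2 (Fin n) → unitInterval) (A : Finset (Fin n)) (o b : Fin n),
      b ∈ A → o ∉ A →
      (∃ y : Fin n, y ∉ A ∧ y ≠ o ∧ (w s(o, y) : ℝ) ≠ 0) →
      (∀ y y' : Fin n, y ∉ A → y' ∉ A → y ≠ o → y' ≠ o →
        (w s(o, y) : ℝ) ≠ 0 → (w s(o, y') : ℝ) ≠ 0 → y = y') →
      (∀ w' : Sym2 (Fin n) → unitInterval,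
        (Finset.univ.filter (fun v : Fin n => ∃ u : Fin n, 0 < (w' s(u, v) : ℝ))).card
          < (Finset.univ.filter (fun v : Fin n => ∃ u : Fin n, 0 < (w s(u, v) : ℝ))).card →
        ∀ (A' : Finset (Fin n)) (o' b' : Fin n), b' ∈ A' → o' ∉ A' →
        ∀ (t : ℝ) (sel : Finset (Fin n) → Fin n), (∀ W, sel W ∈ A') →
          (∀ a ∈ A', 1 - t ≤ (prodBernoulli w').real (openConn a b')) →
          (prodBernoulli w').real ((⋃ a ∈ A', openConn o' a) ∩ (openConn o' b')ᶜ)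
            + ∑ W ∈ (Finset.univ : Finset (Finset (Fin n))).filter (fun W => o' ∈ W ∧ Disjoint W A'),
                (prodBernoulli w').real {ω : BondConfig (Fin n) | openCluster ω o' = (W : Set (Fin n))}
                  * (prodBernoulli w').real (openConnIn ((W : Set (Fin n))ᶜ) (sel W) b')ᶜ
            ≤ t) →
      ∀ (t : ℝ) (sel : Finset (Fin n) → Fin n), (∀ W, sel W ∈ A) →
        (∀ a ∈ A, 1 - t ≤ (prodBernoulli w).real (openConn a b)) →
        (prodBernoulli w).real ((⋃ a ∈ A, openConn o a) ∩ (openConn o b)ᶜ)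
          + ∑ W ∈ (Finset.univ : Finset (Finset (Fin n))).filter (fun W => o ∈ W ∧ Disjoint W A),
              (prodBernoulli w).real {ω : BondConfig (Fin n) | openCluster ω o = (W : Set (Fin n))}
                * (prodBernoulli w).real (openConnIn ((W : Set (Fin n))ᶜ) (sel W) b)ᶜ
          ≤ t := by
  intro n w A o b hb ho hlow huniq IH
  refine goodStep24_main n w A o b hb ho hlow IH ?_
  intro S sel a₀ h2 hoS hSA hSw _ _ _ _
  exfalso
  obtain ⟨y, hy, y', hy', hne⟩ := Finset.one_lt_card.1 h2
  refine hne (huniq y y' (Finset.disjoint_left.1 hSA hy) (Finset.disjoint_left.1 hSA hy')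
    (fun h => hoS (h ▸ hy)) (fun h => hoS (h ▸ hy')) ?_ ?_)
  · exact fun h => hSw y hy (Subtype.ext h)
  · exact fun h => hSw y' hy' (Subtype.ext h)

open Filter Literature.Probability.LatticeModels Literature.Probability.Percolation in
/-- Registered helper stub `stub_goodStepOneBad_k24` of crux stmt-CriticalPhenomena-4576 (siege k24):
**the inductive step `stub_goodStep` when at most ONE low neighbour of `o` is BAD** — bad meaning
less reliable, in the graph `K` with the star of `o` killed, than every relay:
`μ_K(y ↔ b) < μ_K(a ↔ b)` for all `a ∈ A`.  Unconditional; contains Kozma–Nitzan's Theorem 4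
(no low neighbour) and Theorem 5 (one low neighbour) classes for an arbitrary relay set, and every
observer all of whose low neighbours but one are at least as reliable off `o` as the worst relay.
Proof: `goodStep24_main`; a layer with two elements would contain two bad low neighbours.
[cite: KozmaNitzan2024, §3.2 Thms 4–5 (pp. 12–14)] -/
theorem stub_goodStepOneBad_k24 :
    ∀ (n : ℕ) (w : Sym2 (Fin n) → unitInterval) (A : Finset (Fin n)) (o b : Fin n),
      b ∈ A → o ∉ A →
      (∃ y : Fin n, y ∉ A ∧ y ≠ o ∧ (w s(o, y) : ℝ) ≠ 0) →
      (∀ y y' : Fin n, y ∉ A → y' ∉ A → y ≠ o → y' ≠ o →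
        (w s(o, y) : ℝ) ≠ 0 → (w s(o, y') : ℝ) ≠ 0 →
        (∀ a ∈ A, (prodBernoulli (fun e : Sym2 (Fin n) => if o ∈ e then (0 : unitInterval) else w e)).real
            (openConn y b) <
          (prodBernoulli (fun e : Sym2 (Fin n) => if o ∈ e then (0 : unitInterval) else w e)).real
            (openConn a b)) →
        (∀ a ∈ A, (prodBernoulli (fun e : Sym2 (Fin n) => if o ∈ e then (0 : unitInterval) else w e)).real
            (openConn y' b) <
          (prodBernoulli (fun e : Sym2 (Fin n) => if o ∈ e then (0 : unitInterval) else w e)).real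
            (openConn a b)) →
        y = y') →
      (∀ w' : Sym2 (Fin n) → unitInterval,
        (Finset.univ.filter (fun v : Fin n => ∃ u : Fin n, 0 < (w' s(u, v) : ℝ))).card
          < (Finset.univ.filter (fun v : Fin n => ∃ u : Fin n, 0 < (w s(u, v) : ℝ))).card →
        ∀ (A' : Finset (Fin n)) (o' b' : Fin n), b' ∈ A' → o' ∉ A' →
        ∀ (t : ℝ) (sel : Finset (Fin n) → Fin n), (∀ W, sel W ∈ A') →
          (∀ a ∈ A', 1 - t ≤ (prodBernoulli w').real (openConn a b')) →
          (prodBernoulli w').real ((⋃ a ∈ A', openConn o' a) ∩ (openConn o' b')ᶜ)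
            + ∑ W ∈ (Finset.univ : Finset (Finset (Fin n))).filter (fun W => o' ∈ W ∧ Disjoint W A'),
                (prodBernoulli w').real {ω : BondConfig (Fin n) | openCluster ω o' = (W : Set (Fin n))}
                  * (prodBernoulli w').real (openConnIn ((W : Set (Fin n))ᶜ) (sel W) b')ᶜ
            ≤ t) →
      ∀ (t : ℝ) (sel : Finset (Fin n) → Fin n), (∀ W, sel W ∈ A) →
        (∀ a ∈ A, 1 - t ≤ (prodBernoulli w).real (openConn a b)) →
        (prodBernoulli w).real ((⋃ a ∈ A, openConn o a) ∩ (openConn o b)ᶜ)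
          + ∑ W ∈ (Finset.univ : Finset (Finset (Fin n))).filter (fun W => o ∈ W ∧ Disjoint W A),
              (prodBernoulli w).real {ω : BondConfig (Fin n) | openCluster ω o = (W : Set (Fin n))}
                * (prodBernoulli w).real (openConnIn ((W : Set (Fin n))ᶜ) (sel W) b)ᶜ
          ≤ t := by
  intro n w A o b hb ho hlow hone IH
  refine goodStep24_main n w A o b hb ho hlow IH ?_
  intro S sel a₀ h2 hoS hSA hSw _ _ hmin hbad
  exfalso
  obtain ⟨y, hy, y', hy', hne⟩ := Finset.one_lt_card.1 h2
  refine hne (hone y y' (Finset.disjoint_left.1 hSA hy) (Finset.disjoint_left.1 hSA hy')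
    (fun h => hoS (h ▸ hy)) (fun h => hoS (h ▸ hy')) (fun h => hSw y hy (Subtype.ext h))
    (fun h => hSw y' hy' (Subtype.ext h)) (fun a ha => (hbad y hy).trans_le (hmin a ha))
    (fun a ha => (hbad y' hy').trans_le (hmin a ha)))

open Filter Literature.Probability.LatticeModels Literature.Probability.Percolation in
/-- Registered helper stub `stub_goodStepOfGlueGood_k24` of crux stmt-CriticalPhenomena-4576 (siege
k24): **the full inductive step `stub_goodStep` (verbatim signature) from the displayed kernel
GLUE-GOOD** — for every weighting `u`, relay set `A ∋ b`, block `S` disjoint from `A` with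
`|S| ≥ 2` and `μ_u(v ↔ b) < μ_u(a₀ ↔ b)` on `S`, selection `sel W ∈ A` and minimiser `a₀` of
`μ_u(· ↔ b)` over `A`:
`μ_{u/S}(a₀ ↔ b) ≤ μ_{u/S}(S ↔ b) + Σ_{W ∩ A = ∅} μ_{u/S}{∀ x, x ∈ W ↔ S ↔ x} · μ_u(sel W ↔ b in Wᶜ)`
(`u/S` = weight `1` on the non-loop pairs inside `S`).  See the module docstring.
[cite: KozmaNitzan2024, §3.2 (Question 7 p. 36; Thms 4–5 pp. 12–14)] -/
theorem stub_goodStepOfGlueGood_k24 :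
    (∀ (n : ℕ) (u : Sym2 (Fin n) → unitInterval) (A S : Finset (Fin n)) (b a₀ : Fin n)
      (sel : Finset (Fin n) → Fin n),
      b ∈ A → Disjoint S A → 2 ≤ S.card → (∀ W, sel W ∈ A) → a₀ ∈ A →
      (∀ a ∈ A, (prodBernoulli u).real (openConn a₀ b) ≤ (prodBernoulli u).real (openConn a b)) →
      (∀ v ∈ S, (prodBernoulli u).real (openConn v b) < (prodBernoulli u).real (openConn a₀ b)) →
      (prodBernoulli (fun e : Sym2 (Fin n) =>
          if (∀ x ∈ e, x ∈ S) ∧ ¬ e.IsDiag then 1 else u e)).real (openConn a₀ b) ≤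
        (prodBernoulli (fun e : Sym2 (Fin n) =>
            if (∀ x ∈ e, x ∈ S) ∧ ¬ e.IsDiag then 1 else u e)).real (⋃ s ∈ S, openConn s b)
          + ∑ W ∈ (Finset.univ : Finset (Finset (Fin n))).filter (fun W => Disjoint W A),
              (prodBernoulli (fun e : Sym2 (Fin n) =>
                  if (∀ x ∈ e, x ∈ S) ∧ ¬ e.IsDiag then 1 else u e)).real
                  {ω : BondConfig (Fin n) | ∀ x : Fin n, (x ∈ W ↔ ω ∈ ⋃ s ∈ S, openConn s x)}
                * (prodBernoulli u).real (openConnIn ((W : Set (Fin n))ᶜ) (sel W) b)) →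
    ∀ (n : ℕ) (w : Sym2 (Fin n) → unitInterval) (A : Finset (Fin n)) (o b : Fin n),
      b ∈ A → o ∉ A →
      (∃ y : Fin n, y ∉ A ∧ y ≠ o ∧ (w s(o, y) : ℝ) ≠ 0) →
      (∀ w' : Sym2 (Fin n) → unitInterval,
        (Finset.univ.filter (fun v : Fin n => ∃ u : Fin n, 0 < (w' s(u, v) : ℝ))).card
          < (Finset.univ.filter (fun v : Fin n => ∃ u : Fin n, 0 < (w s(u, v) : ℝ))).card →
        ∀ (A' : Finset (Fin n)) (o' b' : Fin n), b' ∈ A' → o' ∉ A' →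
        ∀ (t : ℝ) (sel : Finset (Fin n) → Fin n), (∀ W, sel W ∈ A') →
          (∀ a ∈ A', 1 - t ≤ (prodBernoulli w').real (openConn a b')) →
          (prodBernoulli w').real ((⋃ a ∈ A', openConn o' a) ∩ (openConn o' b')ᶜ)
            + ∑ W ∈ (Finset.univ : Finset (Finset (Fin n))).filter (fun W => o' ∈ W ∧ Disjoint W A'),
                (prodBernoulli w').real {ω : BondConfig (Fin n) | openCluster ω o' = (W : Set (Fin n))}
                  * (prodBernoulli w').real (openConnIn ((W : Set (Fin n))ᶜ) (sel W) b')ᶜ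
            ≤ t) →
      ∀ (t : ℝ) (sel : Finset (Fin n) → Fin n), (∀ W, sel W ∈ A) →
        (∀ a ∈ A, 1 - t ≤ (prodBernoulli w).real (openConn a b)) →
        (prodBernoulli w).real ((⋃ a ∈ A, openConn o a) ∩ (openConn o b)ᶜ)
          + ∑ W ∈ (Finset.univ : Finset (Finset (Fin n))).filter (fun W => o ∈ W ∧ Disjoint W A),
              (prodBernoulli w).real {ω : BondConfig (Fin n) | openCluster ω o = (W : Set (Fin n))}
                * (prodBernoulli w).real (openConnIn ((W : Set (Fin n))ᶜ) (sel W) b)ᶜ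
          ≤ t := by
  intro hGG n w A o b hb ho hlow IH
  refine goodStep24_main n w A o b hb ho hlow IH ?_
  intro S sel a₀ h2 _ hSA _ hsel ha₀ hmin hbad
  exact hGG n (fun e : Sym2 (Fin n) => if o ∈ e then (0 : unitInterval) else w e) A S b a₀
    (fun W' => sel (insert o W')) hb hSA h2 (fun W' => hsel _) ha₀ hmin hbad

end

end Summit.CriticalPhenomena.PercolationContinuityZ3.Theorems
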